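import Literature.AlgebraicGeometry.Motives.UniversalHyperplaneSectionFamilyPencil
import HarnessLib

/-!
# The family of hyperplane sections of the fibres of a smooth projective family, VI: the pencil over the good part of its line

Topic `Literature/AlgebraicGeometry/Motives` (theorems only). Continuing `…FamilyPencil`:

* `preimage_le_preimage_goodLocus` — the part of a base `T ⟶ (ℙᴺ)^*` over the generic-smoothness open
  maps into the good locus `G`;
* `smoothOfRelativeDimension_snd_morphismRestrict` — the base change of `g` to `T` is smooth of relative
  dimension `n` over every open mapped into `G`;
* `pencil_smooth_and_members_iso` — over the good part `Λ⁻¹ U` of its line, the pencil of `X_t` is smooth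
  of relative dimension `n` and its members are smooth projective `n`-folds isomorphic, over `𝒳`, to
  the corresponding fibres of `g` (the surjective closed immersion `X̃_t ⟶ 𝒴_L` is an isomorphism over
  the reduced `𝒴_L|_{Λ⁻¹U}`).

## References

* [VoisinHodgeII2003] C. Voisin, Hodge Theory and Complex Algebraic Geometry II, CUP 2003, §2.1.1 and §3.2.2.
* [StacksProject] The Stacks Project, Tags 0356, 04XV, 01T6.
-/

noncomputable section

open CategoryTheory CategoryTheory.Limits AlgebraicGeometry TopologicalSpace MonoidalCategory
  CartesianMonoidalCategory
open Literature.AlgebraicGeometry.HodgeTheory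
open Literature.AlgebraicGeometry.Motives.UniversalHyperplaneSection

universe u

namespace Literature.AlgebraicGeometry.Motives.SectionFamily

/-! ### Over the good part of the line: the pencil IS the line of the family of sections -/
section GoodLine

open Literature.AlgebraicGeometry.Resolution

variable {n N d : ℕ} {𝒳 S : SchemeOver ℂ} (f : 𝒳 ⟶ S) (e : 𝒳 ⟶ projectiveSpace N ℂ)
  (t : ComplexPoints S) (Λ : projectiveSpace 1 ℂ ⟶ dualProjectiveSpace N ℂ)

/-- **The good part of the line lies over the good locus.** If every complex point `H` of an open
`U ⊆ (ℙᴺ)^*` has `X_t ∩ H` smooth of dimension `n`, then the open `Λ⁻¹ U ⊆ ℙ¹` is mapped by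
`ℓ = Λ ≫ (H ↦ (t, H))` into every open `G ⊆ S × (ℙᴺ)^*` whose complex points are characterised by
that smoothness (a non-empty locally closed subset of `ℙ¹` has a closed, i.e. complex, point).
[folklore] -/
theorem preimage_le_preimage_goodLocus {T : SchemeOver ℂ} [LocallyOfFiniteType T.hom]
    (ΛT : T ⟶ dualProjectiveSpace N ℂ) (U : (dualProjectiveSpace N ℂ).left.Opens)
    (hU : ∀ H : ComplexPoints (dualProjectiveSpace N ℂ), H.pt ∈ U →
      SmoothOfRelativeDimension n
        (fiberOver (CartesianMonoidalCategory.lift (toX N e ≫ f) (proj N e)) (CartesianMonoidalCategory.lift t H)).hom)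
    (G : (S ⊗ dualProjectiveSpace N ℂ).left.Opens)
    (hG : ∀ b : ComplexPoints (S ⊗ dualProjectiveSpace N ℂ), b.pt ∈ G ↔
      SmoothOfRelativeDimension n (fiberOver (CartesianMonoidalCategory.lift (toX N e ≫ f) (proj N e)) b).hom) :
    ΛT.left ⁻¹ᵁ U ≤ (ΛT ≫ CartesianMonoidalCategory.lift (toSpecOver (dualProjectiveSpace N ℂ) ≫ t)
      (𝟙 (dualProjectiveSpace N ℂ))).left ⁻¹ᵁ G := by
  intro x hx
  by_contra hxG
  haveI : JacobsonSpace T.left := LocallyOfFiniteType.jacobsonSpace T.hom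
  -- the locally closed `Λ⁻¹ U ∖ ℓ⁻¹ G` has a closed point, a complex point `λ`
  have hlc : IsLocallyClosed ((ΛT.left ⁻¹ᵁ U : Set T.left) ∩
      ((ΛT ≫ CartesianMonoidalCategory.lift (toSpecOver (dualProjectiveSpace N ℂ) ≫ t)
        (𝟙 (dualProjectiveSpace N ℂ))).left ⁻¹ᵁ G : Set T.left)ᶜ) :=
    (ΛT.left ⁻¹ᵁ U).isOpen.isLocallyClosed.inter (Opens.isOpen _).isClosed_compl.isLocallyClosed
  have hne : ((ΛT.left ⁻¹ᵁ U : Set T.left) ∩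
      ((ΛT ≫ CartesianMonoidalCategory.lift (toSpecOver (dualProjectiveSpace N ℂ) ≫ t)
        (𝟙 (dualProjectiveSpace N ℂ))).left ⁻¹ᵁ G : Set T.left)ᶜ).Nonempty := ⟨x, hx, hxG⟩
  obtain ⟨y, ⟨hyU, hyG⟩, hyc⟩ := nonempty_inter_closedPoints hne hlc
  obtain ⟨lam, rfl⟩ := EsnaultLevineViehweg.exists_algPoints_pt_eq (X := T) (k := ℂ) (mem_closedPoints_iff.mp hyc)
  apply hyG
  change (AlgPoints.map (ΛT ≫ CartesianMonoidalCategory.lift (toSpecOver (dualProjectiveSpace N ℂ) ≫ t)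
      (𝟙 (dualProjectiveSpace N ℂ))) lam).pt ∈ G
  rw [AlgPoints.map_comp_apply, map_slice, hG]
  exact hU _ hyU

/-- **The line family is smooth of relative dimension `n` over the good part of the line**: over an
open `V ⊆ T` mapped by `ℓ : T ⟶ S × (ℙᴺ)^*` into the good locus `G`, the base change
`g_T : 𝒴 ×_{S × (ℙᴺ)^*} T ⟶ T` restricted to `V` is a base change of `g|_G`. [folklore] -/
theorem smoothOfRelativeDimension_snd_morphismRestrict {T : SchemeOver ℂ}
    (ℓ : T ⟶ S ⊗ dualProjectiveSpace N ℂ) (G : (S ⊗ dualProjectiveSpace N ℂ).left.Opens)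
    [SmoothOfRelativeDimension n ((CartesianMonoidalCategory.lift (toX N e ≫ f) (proj N e)).left ∣_ G)]
    (V : T.left.Opens) (hV : V ≤ ℓ.left ⁻¹ᵁ G) :
    SmoothOfRelativeDimension n
      ((familyPullback.snd (CartesianMonoidalCategory.lift (toX N e ≫ f) (proj N e)) ℓ).left ∣_ V) := by
  set g := CartesianMonoidalCategory.lift (toX N e ≫ f) (proj N e) with hg
  -- `V ⟶ T ⟶ S × (ℙᴺ)^*` factors through `G`
  have hrange : Set.range (V.ι ≫ ℓ.left) ⊆ Set.range G.ι := by
    rw [Scheme.Opens.range_ι, Scheme.Hom.comp_base, TopCat.coe_comp, Set.range_comp, Scheme.Opens.range_ι]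
    rintro _ ⟨x, hx, rfl⟩
    exact hV hx
  set m := IsOpenImmersion.lift G.ι (V.ι ≫ ℓ.left) hrange with hm
  have hmfac : m ≫ G.ι = V.ι ≫ ℓ.left := IsOpenImmersion.lift_fac _ _ _
  -- the big cartesian square `g_T⁻¹ V ⟶ 𝒴` over `V ⟶ G ⟶ S × (ℙᴺ)^*`
  have big : IsPullback (((familyPullback.snd g ℓ).left ⁻¹ᵁ V).ι ≫ (familyPullback.fst g ℓ).left)
      ((familyPullback.snd g ℓ).left ∣_ V) g.left (m ≫ G.ι) := by
    rw [hmfac]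
    exact (isPullback_morphismRestrict (familyPullback.snd g ℓ).left V).flip.paste_horiz
      ((familyPullback.isPullback g ℓ).map (Over.forget _))
  have key := IsPullback.of_right' big (isPullback_morphismRestrict g.left G).flip
  haveI := smoothOfRelativeDimension_isStableUnderBaseChange (n := n)
  exact MorphismProperty.of_isPullback (P := @SmoothOfRelativeDimension n) key ‹_›

/-- **Fibres of a surjective closed immersion over a common base with reduced target fibre are
isomorphisms**: for `Θ : X ⟶ Y` over `B` (`Θ ≫ q = p`) a surjective closed immersion and a complex
point `b` of `B` whose fibre `Y_b` is reduced, the induced `X_b ⟶ Y_b` (a surjective closed immersion,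
base change of `Θ`) is an isomorphism over `Y` (Mathlib `isIso_of_isClosedImmersion_of_surjective`).
[folklore] -/
theorem exists_fiberIso_of_isClosedImmersion_of_surjective {X Y B : SchemeOver ℂ} (p : X ⟶ B) (q : Y ⟶ B)
    (Θ : X ⟶ Y) (hΘ : Θ ≫ q = p) [IsClosedImmersion Θ.left] [Surjective Θ.left] (b : ComplexPoints B)
    [IsReduced (fiberOver q b).left] :
    ∃ ψ : fiberOver p b ≅ fiberOver q b, ψ.hom ≫ fiberι q b = fiberι p b ≫ Θ := by
  have hΘl : Θ.left ≫ q.left = p.left := by rw [← Over.comp_left, hΘ]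
  set ψl : pullback p.left b.left ⟶ pullback q.left b.left :=
    pullback.lift (pullback.fst p.left b.left ≫ Θ.left) (pullback.snd p.left b.left)
      (by rw [Category.assoc, hΘl]; exact pullback.condition) with hψl
  have h₁ : ψl ≫ pullback.fst q.left b.left = pullback.fst p.left b.left ≫ Θ.left := pullback.lift_fst _ _ _
  have h₂ : ψl ≫ pullback.snd q.left b.left = pullback.snd p.left b.left := pullback.lift_snd _ _ _
  -- `ψl` is the base change of `Θ` along `Y_b ⟶ Y`
  have sq : IsPullback (ψl ≫ pullback.snd q.left b.left) (pullback.fst p.left b.left) b.left (Θ.left ≫ q.left) := by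
    rw [h₂, hΘl]
    exact (IsPullback.of_hasPullback p.left b.left).flip
  have L := IsPullback.of_right sq h₁ (IsPullback.of_hasPullback q.left b.left).flip
  haveI : IsClosedImmersion ψl := MorphismProperty.of_isPullback (P := @IsClosedImmersion) L.flip ‹_›
  haveI : Surjective ψl := MorphismProperty.of_isPullback (P := @Surjective) L.flip ‹_›
  haveI : IsReduced (pullback q.left b.left) := ‹IsReduced (fiberOver q b).left›
  haveI : IsIso ψl := isIso_of_isClosedImmersion_of_surjective ψl
  let ψ : fiberOver p b ⟶ fiberOver q b := Over.homMk ψl (by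
    change ψl ≫ pullback.fst q.left b.left ≫ Y.hom = pullback.fst p.left b.left ≫ X.hom
    rw [← Category.assoc, h₁, Category.assoc, Over.w Θ])
  haveI : IsIso ψ := by
    haveI : IsIso ((Over.forget _).map ψ) := inferInstanceAs (IsIso ψl)
    exact isIso_of_reflects_iso ψ (Over.forget _)
  exact ⟨asIso ψ, Over.OverMorphism.ext h₁⟩

/-- **Over the good part of the line, the pencil of `X_t` is a smooth family whose members are
smooth projective `n`-folds isomorphic to the hyperplane sections of the family.** Let `U ⊆ (ℙᴺ)^*`
be an open all of whose complex points `H` have `X_t ∩ H` smooth of dimension `n`, `(a₀, a₁)` a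
pencil of `X_t` with smooth projective total space `X̃_t` and geometrically connected net map `π`,
and `Λ : ℙ¹ ⟶ (ℙᴺ)^*` its line (`[w] ↦ [w₁ a₀ − w₀ a₁]`). Then over `Λ⁻¹ U` the net map `π` is smooth
of relative dimension `n`, and every member `π⁻¹(λ)`, `λ ∈ Λ⁻¹U(ℂ)`, is a smooth projective
`n`-fold isomorphic — over `𝒳` — to the fibre of `g` over `(t, Λ λ)`: over `Λ⁻¹ U ⊆ ℓ⁻¹ G`
(`preimage_le_preimage_goodLocus`) the line `𝒴_L` is smooth over `ℙ¹`
(`smoothOfRelativeDimension_snd_morphismRestrict`), in particular reduced, so the surjective closed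
immersion `X̃_t ⟶ 𝒴_L` (`exists_pencilToSectionLine`) is an isomorphism there, on the families and
on the fibres (`exists_fiberIso_of_isClosedImmersion_of_surjective`); geometric irreducibility of the
members from the geometric connectedness of `π`. [cite: VoisinHodgeII2003, §2.1.1 and §3.2.2]
[cite: StacksProject, Tag 04XV] -/
theorem pencil_smooth_and_members_iso (hf : IsSmoothProjectiveFamily f (n + 1)) [IrreducibleSpace S.left]
    [SmoothOfRelativeDimension d S.hom] [IsAffine S.left] [IsAffineHom e.left] (hN : 2 ≤ N)
    [IsClosedImmersion (fiberι f t ≫ e).left] (a : Fin (1 + 1) → Fin (N + 1) → ℂ)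
    (hXta : IsSmoothProjective (n + 1) (LinearSectionNet.total (fiberι f t ≫ e) a))
    [GeometricallyConnected (LinearSectionNet.proj (fiberι f t ≫ e) a).left]
    (hΛ : ∀ (w : Fin (1 + 1) → ℂ) (hw : w ≠ 0), ∃ hc : (fun i => w 1 * a 0 i - w 0 * a 1 i) ≠ 0,
      AlgPoints.map Λ (ProjectiveSpace.pointOfVec ℂ w hw) =
        ProjectiveSpace.pointOfVec ℂ (fun i => w 1 * a 0 i - w 0 * a 1 i) hc)
    (U : (dualProjectiveSpace N ℂ).left.Opens)
    (hU : ∀ H : ComplexPoints (dualProjectiveSpace N ℂ), H.pt ∈ U →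
      SmoothOfRelativeDimension n
        (fiberOver (CartesianMonoidalCategory.lift (toX N e ≫ f) (proj N e)) (CartesianMonoidalCategory.lift t H)).hom) :
    SmoothOfRelativeDimension n ((LinearSectionNet.proj (fiberι f t ≫ e) a).left ∣_ (Λ.left ⁻¹ᵁ U)) ∧
    ∀ lam : ComplexPoints (projectiveSpace 1 ℂ), lam.pt ∈ Λ.left ⁻¹ᵁ U →
      IsSmoothProjective n (fiberOver (LinearSectionNet.proj (fiberι f t ≫ e) a) lam) ∧
      ∃ ψ : fiberOver (LinearSectionNet.proj (fiberι f t ≫ e) a) lam ≅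
          fiberOver (CartesianMonoidalCategory.lift (toX N e ≫ f) (proj N e))
            (AlgPoints.map (Λ ≫ CartesianMonoidalCategory.lift (toSpecOver (dualProjectiveSpace N ℂ) ≫ t)
              (𝟙 (dualProjectiveSpace N ℂ))) lam),
        ψ.hom ≫ fiberι _ _ ≫ toX N e =
          fiberι (LinearSectionNet.proj (fiberι f t ≫ e) a) lam ≫ LinearSectionNet.blowDown (fiberι f t ≫ e) a ≫ fiberι f t := by
  haveI : Smooth S.hom := SmoothOfRelativeDimension.smooth d _
  haveI : LocallyOfFiniteType S.hom := inferInstance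
  obtain ⟨G, hGsm, hGiff⟩ := exists_goodLocus f e hf (d := d) hN
  haveI := hGsm
  obtain ⟨ΘL, hΘL₂, hΘLX, hcl, hsurj⟩ := exists_pencilToSectionLine f e t a Λ hf hΛ
  haveI := hcl
  haveI := hsurj
  haveI : LocallyOfFiniteType (projectiveSpace 1 ℂ).hom := inferInstance
  have hUG := preimage_le_preimage_goodLocus f e t Λ U hU G hGiff
  -- notation-free abbreviations
  have hsmL := smoothOfRelativeDimension_snd_morphismRestrict (n := n) f e
    (Λ ≫ CartesianMonoidalCategory.lift (toSpecOver (dualProjectiveSpace N ℂ) ≫ t) (𝟙 (dualProjectiveSpace N ℂ)))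
    G (Λ.left ⁻¹ᵁ U) hUG
  haveI := hsmL
  haveI : SmoothOfRelativeDimension 1 (projectiveSpace 1 ℂ).hom :=
    (isSmoothProjective_projectiveSpace_holds ℂ 1).smoothOfRelativeDimension
  -- the line family over `Λ⁻¹ U` is smooth over `ℂ`, hence reduced
  haveI hred : IsReduced ((familyPullback.snd (CartesianMonoidalCategory.lift (toX N e ≫ f) (proj N e))
      (Λ ≫ CartesianMonoidalCategory.lift (toSpecOver (dualProjectiveSpace N ℂ) ≫ t) (𝟙 (dualProjectiveSpace N ℂ)))).left ⁻¹ᵁ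
        (Λ.left ⁻¹ᵁ U) : Scheme) := by
    have h : Smooth (((familyPullback.snd (CartesianMonoidalCategory.lift (toX N e ≫ f) (proj N e))
        (Λ ≫ CartesianMonoidalCategory.lift (toSpecOver (dualProjectiveSpace N ℂ) ≫ t) (𝟙 (dualProjectiveSpace N ℂ)))).left ∣_
          (Λ.left ⁻¹ᵁ U)) ≫ (Λ.left ⁻¹ᵁ U).ι ≫ (projectiveSpace 1 ℂ).hom) := by
      haveI : Smooth ((familyPullback.snd (CartesianMonoidalCategory.lift (toX N e ≫ f) (proj N e))
        (Λ ≫ CartesianMonoidalCategory.lift (toSpecOver (dualProjectiveSpace N ℂ) ≫ t) (𝟙 (dualProjectiveSpace N ℂ)))).left ∣_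
          (Λ.left ⁻¹ᵁ U)) := SmoothOfRelativeDimension.smooth n _
      haveI : Smooth (projectiveSpace 1 ℂ).hom := SmoothOfRelativeDimension.smooth 1 _
      infer_instance
    haveI := h
    exact isReduced_of_smooth_over_field (((familyPullback.snd (CartesianMonoidalCategory.lift (toX N e ≫ f) (proj N e))
        (Λ ≫ CartesianMonoidalCategory.lift (toSpecOver (dualProjectiveSpace N ℂ) ≫ t) (𝟙 (dualProjectiveSpace N ℂ)))).left ∣_
          (Λ.left ⁻¹ᵁ U)) ≫ (Λ.left ⁻¹ᵁ U).ι ≫ (projectiveSpace 1 ℂ).hom)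
  -- `π|_{Λ⁻¹U} = (ΘL restricted) ≫ (g_L restricted)`, an isomorphism followed by a smooth map
  have key : ∀ q : (LinearSectionNet.total (fiberι f t ≫ e) a).left ⟶ (projectiveSpace 1 ℂ).left,
      q = ΘL.left ≫ (familyPullback.snd (CartesianMonoidalCategory.lift (toX N e ≫ f) (proj N e))
        (Λ ≫ CartesianMonoidalCategory.lift (toSpecOver (dualProjectiveSpace N ℂ) ≫ t) (𝟙 (dualProjectiveSpace N ℂ)))).left →
      SmoothOfRelativeDimension n (q ∣_ (Λ.left ⁻¹ᵁ U)) := by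
    rintro _ rfl
    rw [morphismRestrict_comp]
    haveI : IsClosedImmersion (ΘL.left ∣_ (familyPullback.snd (CartesianMonoidalCategory.lift (toX N e ≫ f) (proj N e))
        (Λ ≫ CartesianMonoidalCategory.lift (toSpecOver (dualProjectiveSpace N ℂ) ≫ t) (𝟙 (dualProjectiveSpace N ℂ)))).left ⁻¹ᵁ
          (Λ.left ⁻¹ᵁ U)) := IsZariskiLocalAtTarget.restrict hcl _
    haveI : Surjective (ΘL.left ∣_ (familyPullback.snd (CartesianMonoidalCategory.lift (toX N e ≫ f) (proj N e))
        (Λ ≫ CartesianMonoidalCategory.lift (toSpecOver (dualProjectiveSpace N ℂ) ≫ t) (𝟙 (dualProjectiveSpace N ℂ)))).left ⁻¹ᵁ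
          (Λ.left ⁻¹ᵁ U)) := IsZariskiLocalAtTarget.restrict hsurj _
    haveI : IsIso (ΘL.left ∣_ (familyPullback.snd (CartesianMonoidalCategory.lift (toX N e ≫ f) (proj N e))
        (Λ ≫ CartesianMonoidalCategory.lift (toSpecOver (dualProjectiveSpace N ℂ) ≫ t) (𝟙 (dualProjectiveSpace N ℂ)))).left ⁻¹ᵁ
          (Λ.left ⁻¹ᵁ U)) := isIso_of_isClosedImmersion_of_surjective _
    have h : SmoothOfRelativeDimension (0 + n) (ΘL.left ∣_ (familyPullback.snd (CartesianMonoidalCategory.lift (toX N e ≫ f) (proj N e))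
        (Λ ≫ CartesianMonoidalCategory.lift (toSpecOver (dualProjectiveSpace N ℂ) ≫ t) (𝟙 (dualProjectiveSpace N ℂ)))).left ⁻¹ᵁ
          (Λ.left ⁻¹ᵁ U) ≫
        (familyPullback.snd (CartesianMonoidalCategory.lift (toX N e ≫ f) (proj N e))
          (Λ ≫ CartesianMonoidalCategory.lift (toSpecOver (dualProjectiveSpace N ℂ) ≫ t) (𝟙 (dualProjectiveSpace N ℂ)))).left ∣_
          (Λ.left ⁻¹ᵁ U)) := inferInstance
    rwa [Nat.zero_add] at h
  have hπL : (LinearSectionNet.proj (fiberι f t ≫ e) a).left =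
      ΘL.left ≫ (familyPullback.snd (CartesianMonoidalCategory.lift (toX N e ≫ f) (proj N e))
        (Λ ≫ CartesianMonoidalCategory.lift (toSpecOver (dualProjectiveSpace N ℂ) ≫ t) (𝟙 (dualProjectiveSpace N ℂ)))).left := by
    rw [← Over.comp_left, hΘL₂]
  have part1 := key _ hπL
  refine ⟨part1, fun lam hlam => ?_⟩
  haveI := part1
  -- the fibre of `g` over `(t, Λ λ)` is smooth, hence reduced, and so is the fibre of `g_L` over `λ`
  have hb : SmoothOfRelativeDimension n (fiberOver (CartesianMonoidalCategory.lift (toX N e ≫ f) (proj N e))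
      (AlgPoints.map (Λ ≫ CartesianMonoidalCategory.lift (toSpecOver (dualProjectiveSpace N ℂ) ≫ t)
        (𝟙 (dualProjectiveSpace N ℂ))) lam)).hom := by
    rw [AlgPoints.map_comp_apply, map_slice]
    exact hU _ hlam
  haveI : IsReduced (fiberOver (CartesianMonoidalCategory.lift (toX N e ≫ f) (proj N e))
      (AlgPoints.map (Λ ≫ CartesianMonoidalCategory.lift (toSpecOver (dualProjectiveSpace N ℂ) ≫ t)
        (𝟙 (dualProjectiveSpace N ℂ))) lam)).left := by
    haveI := hb
    haveI : Smooth (fiberOver (CartesianMonoidalCategory.lift (toX N e ≫ f) (proj N e))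
      (AlgPoints.map (Λ ≫ CartesianMonoidalCategory.lift (toSpecOver (dualProjectiveSpace N ℂ) ≫ t)
        (𝟙 (dualProjectiveSpace N ℂ))) lam)).hom := SmoothOfRelativeDimension.smooth n _
    exact isReduced_of_smooth_over_field (fiberOver _ _).hom
  haveI : IsReduced (fiberOver (familyPullback.snd (CartesianMonoidalCategory.lift (toX N e ≫ f) (proj N e))
      (Λ ≫ CartesianMonoidalCategory.lift (toSpecOver (dualProjectiveSpace N ℂ) ≫ t) (𝟙 (dualProjectiveSpace N ℂ)))) lam).left :=
    isReduced_of_isOpenImmersion (fiberOverFamilyPullbackIso (CartesianMonoidalCategory.lift (toX N e ≫ f) (proj N e))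
      (Λ ≫ CartesianMonoidalCategory.lift (toSpecOver (dualProjectiveSpace N ℂ) ≫ t) (𝟙 (dualProjectiveSpace N ℂ))) lam).hom.left
  obtain ⟨ψ₁, hψ₁⟩ := exists_fiberIso_of_isClosedImmersion_of_surjective (LinearSectionNet.proj (fiberι f t ≫ e) a)
    (familyPullback.snd _ _) ΘL hΘL₂ lam
  refine ⟨⟨?_, ?_, ?_⟩, ψ₁ ≪≫ fiberOverFamilyPullbackIso _ _ lam, ?_⟩
  · exact smoothOfRelativeDimension_fiberOver_hom (LinearSectionNet.proj (fiberι f t ≫ e) a) (Λ.left ⁻¹ᵁ U) lam hlam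
  · haveI : IsSeparated (projectiveSpace 1 ℂ).hom := inferInstance
    exact Literature.AlgebraicGeometry.Motives.isProjectiveOver_fiberOver (LinearSectionNet.proj (fiberι f t ≫ e) a)
      hXta.isProjectiveOver lam
  · -- adapted from `FiberNet.isSmoothProjective_fiberOver_smoothFamily`
    have hsm : SmoothOfRelativeDimension n (fiberOver (LinearSectionNet.proj (fiberι f t ≫ e) a) lam).hom :=
      smoothOfRelativeDimension_fiberOver_hom (LinearSectionNet.proj (fiberι f t ≫ e) a) (Λ.left ⁻¹ᵁ U) lam hlam
    haveI := isIso_specOver_self_hom (k := ℂ)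
    rw [fiberOver_hom] at hsm ⊢
    have hsm' : SmoothOfRelativeDimension n (pullback.snd (LinearSectionNet.proj (fiberι f t ≫ e) a).left lam.left) :=
      (MorphismProperty.cancel_right_of_respectsIso (@SmoothOfRelativeDimension n) _ _).mp hsm
    have hirr := @geometricallyIrreducible_of_geometricallyConnected_of_smoothOfRelativeDimension
      ℂ _ _ (pullback.snd (LinearSectionNet.proj (fiberι f t ≫ e) a).left lam.left) n hsm'
      (inferInstanceAs (GeometricallyConnected (pullback.snd (LinearSectionNet.proj (fiberι f t ≫ e) a).left lam.left)))
    exact (MorphismProperty.cancel_right_of_respectsIso (@GeometricallyIrreducible) _ _).mpr hirr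
  · rw [Iso.trans_hom, Category.assoc, ← Category.assoc (fiberOverFamilyPullbackIso _ _ lam).hom,
      fiberOverFamilyPullbackIso_hom_fiberι, Category.assoc (fiberι _ lam), ← Category.assoc ψ₁.hom, hψ₁,
      Category.assoc, hΘLX]

end GoodLine

end Literature.AlgebraicGeometry.Motives.SectionFamily

end
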